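import Literature.Barriers.BirchSwinnertonDyer.RankNotSumOfLocalInvariantsC3C3Proofs
import HarnessLib

/-!
# Mordell–Weil rank `1` by Galois descent through a group of order `p²` and exponent `p`

Generalisation of the sibling file `RankNotSumOfLocalInvariantsC3C3Proofs.lean` (the case `p = 3`, used for the field `F₃` with `Gal(F₃/ℚ) ≅ C₃ × C₃` of the proof of Theorem 2 of
T. Dokchitser–V. Dokchitser, *A note on the Mordell–Weil rank modulo `n`*, J. Number Theory 131
(2011) 1833–1839) to an arbitrary prime `p`, so as to cover also `F₅` ("the degree 25 subfield of
`ℚ(ζ₁₁, ζ₂₄₁)`", `Gal(F₅/ℚ) ≅ C₅ × C₅`, tree file `RankNotSumOfLocalInvariantsF5.lean`), whose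
rank leaf `DokchitserDokchitser2011_mordellWeilRank_480a1_F5` the source also obtains by
"2-descent […] over all minimal non-trivial subfields", i.e. over the six quintic subfields.
Everything here is proved.

* `prime_smul_eq`: for a group `G` of order `p²` acting additively on an abelian group `M`,
  `p(p-1) • m = ∑_{g ≠ 1} T_g m - (p-1) • N m` with `T_g m = ∑_{i<p} gⁱ m` and `N m = ∑_g g m`
  (for `0 < i < p` the map `g ↦ gⁱ` permutes `G`, Mathlib `Nat.Coprime.pow_left_bijective`); if
  `G` has exponent `p`, `T_g m` is fixed by `g` (`apply_sum_range_pow`) — in `ℤ[C_p × C_p]`: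
  `p(p-1) = ∑_{g ≠ 1} (1 + g + ⋯ + gᵖ⁻¹) - (p-1) ∑_g g`, every `g ≠ 1` lying in exactly one of
  the `p + 1` subgroups of order `p`.
* `dep_of_exponent_prime`: hence if every element fixed by some `g ≠ 1` is rationally dependent on
  a fixed `m₀`, so is every element of `M`.
* `mordellWeilRank_baseChange_eq_one_of_exponent_prime`: for a number field `F` with
  `|Aut(F/ℚ)| = p²` of exponent `p`, an elliptic curve `E/ℚ` with a rational point of infinite
  order, and number fields `K_σ → F` covering the fixed field of each `σ ≠ 1` with
  `rank_ℤ E(K_σ) ≤ 1`: `rank_ℤ E(F) = 1` (as in the `p = 3` file: transport of coordinates,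
  `LinearIndependent.fintype_card_le_finrank` over `K_σ`, the tree's Mordell–Weil theorem
  `WeierstrassCurve.module_finite_point_holds`, and `finrank_eq_one_of_forall_dep`).

This is the case `rk M^H = rk M^G = 1` (all `H ≤ G` of order `p`) of the Artin formalism
`rk M = rk M^G + ∑_{H ≤ G, |H| = p} (rk M^H - rk M^G)` for `G = C_p × C_p`. Design as in the
`p = 3` file (unbundled action `ρ : G → M →+ M`, elementwise rational dependence, generic field).

## References

* T. Dokchitser, V. Dokchitser, *A note on the Mordell–Weil rank modulo `n`*, J. Number Theory 131
  (2011) 1833–1839, arXiv:0910.4588, proof of Thm. 2. [DokchitserDokchitser2011RankModN]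
* J. H. Silverman, *The Arithmetic of Elliptic Curves*, 2nd ed., GTM 106 (2009), VIII.§1 and
  Thm. VIII.6.7 (Mordell–Weil). [SilvermanAEC2009]
-/

noncomputable section

open scoped Classical

open Module

namespace Literature.Barriers.BirchSwinnertonDyer.DokchitserDokchitser2011

/-! ### Algebra: groups of order `p²` and exponent `p` -/

section Prime

variable {M : Type*} [AddCommGroup M] {G : Type*} [Group G] (ρ : G → M →+ M)
  (hmul : ∀ (g h : G) (m : M), ρ (g * h) m = ρ g (ρ h m)) (hone : ∀ m : M, ρ 1 m = m)

include hmul in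
/-- If `gᵖ = 1`, the partial trace `T_g m = ∑_{i<p} gⁱ m` is fixed by `g` (the sum is cyclically
shifted). [folklore] -/
theorem apply_sum_range_pow {p : ℕ} {g : G} (hg : g ^ p = 1) (m : M) :
    ρ g (∑ i ∈ Finset.range p, ρ (g ^ i) m) = ∑ i ∈ Finset.range p, ρ (g ^ i) m := by
  rw [map_sum]
  simp_rw [← hmul, ← pow_succ']
  have h := Finset.sum_range_succ' (fun i => ρ (g ^ i) m) p
  rw [Finset.sum_range_succ, hg, pow_zero] at h
  exact (add_right_cancel h).symm

include hone in
/-- `∑_g ∑_{i<p} gⁱ m = p² • m + (p - 1) • N m` for `|G| = p²`: for `0 < i < p` the map `g ↦ gⁱ`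
is a bijection of `G` (`i` is prime to `|G|`, Mathlib `Nat.Coprime.pow_left_bijective`), so each
inner sum over `g` with `i ≠ 0` is the norm `N m = ∑_g g m`. [folklore] -/
theorem sum_sum_range_pow [Fintype G] {p : ℕ} (hp : p.Prime) (hcard : Fintype.card G = p ^ 2)
    (m : M) : ∑ g, ∑ i ∈ Finset.range p, ρ (g ^ i) m =
      (p ^ 2 : ℕ) • m + (p - 1 : ℕ) • ∑ g, ρ g m := by
  rw [Finset.sum_comm]
  obtain ⟨q, rfl⟩ : ∃ q, p = q + 1 := ⟨p - 1, (Nat.succ_pred_eq_of_pos hp.pos).symm⟩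
  rw [Finset.sum_range_succ', Nat.add_sub_cancel]
  have hbij : ∀ i ∈ Finset.range q, ∑ g, ρ (g ^ (i + 1)) m = ∑ g, ρ g m := fun i hi => by
    have hcop : (Nat.card G).Coprime (i + 1) := by
      rw [Nat.card_eq_fintype_card, hcard]
      exact Nat.Coprime.pow_left 2 ((Nat.Prime.coprime_iff_not_dvd hp).mpr
        (Nat.not_dvd_of_pos_of_lt i.succ_pos (by simpa using Finset.mem_range.mp hi)))
    exact Function.Bijective.sum_comp (Nat.Coprime.pow_left_bijective hcop) fun g => ρ g m
  rw [Finset.sum_congr rfl hbij, Finset.sum_const, Finset.card_range]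
  simp only [pow_zero, hone, Finset.sum_const, Finset.card_univ, hcard]
  rw [add_comm]

include hone in
/-- **The descent identity for a group of order `p²`**:
`p(p-1) • m = ∑_{g ≠ 1} T_g m - (p-1) • N m` with `T_g m = ∑_{i<p} gⁱ m` (fixed by `g` when
`gᵖ = 1`) and `N m = ∑_g g m` (fixed by `G`) — for `G` of exponent `p`, in `ℤ[G]`:
`p(p-1) = ∑_{g ≠ 1} (1 + g + ⋯ + gᵖ⁻¹) - (p-1) ∑_g g` (every `g ≠ 1` lies in exactly one of the
`p + 1` subgroups of order `p`). [folklore] -/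
theorem prime_smul_eq [Fintype G] {p : ℕ} (hp : p.Prime) (hcard : Fintype.card G = p ^ 2)
    (m : M) :
    ((p : ℤ) * (p - 1)) • m = ∑ g ∈ Finset.univ.erase 1, ∑ i ∈ Finset.range p, ρ (g ^ i) m -
      ((p : ℤ) - 1) • ∑ g, ρ g m := by
  have h1 : ∑ i ∈ Finset.range p, ρ ((1 : G) ^ i) m = (p : ℤ) • m := by
    simp only [one_pow, hone, Finset.sum_const, Finset.card_range, natCast_zsmul]
  have h := sum_sum_range_pow ρ hone hp hcard m
  rw [← Finset.add_sum_erase _ _ (Finset.mem_univ (1 : G)), h1] at h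
  rw [eq_sub_of_add_eq' h, ← natCast_zsmul, ← natCast_zsmul, Nat.cast_sub hp.one_le]
  push_cast
  module

/-- **Descent through a group of order `p²` and exponent `p`** (`G ≅ C_p × C_p`): if for every
`g ≠ 1` every element fixed by `g` is rationally dependent on a fixed `m₀`, so is every element
of `M` (`prime_smul_eq`). [folklore] -/
theorem dep_of_exponent_prime [Fintype G] {p : ℕ} (hp : p.Prime)
    (hmul : ∀ (g h : G) (m : M), ρ (g * h) m = ρ g (ρ h m)) (hone : ∀ m : M, ρ 1 m = m)
    (hexp : ∀ g : G, g ^ p = 1) (hcard : Fintype.card G = p ^ 2) {m₀ : M}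
    (hdep : ∀ g : G, g ≠ 1 → ∀ x : M, ρ g x = x → ∃ a b : ℤ, a ≠ 0 ∧ a • x = b • m₀) (m : M) :
    ∃ a b : ℤ, a ≠ 0 ∧ a • m = b • m₀ := by
  obtain ⟨g₀, hg₀⟩ := Fintype.exists_ne_of_one_lt_card
    (by rw [hcard]; exact Nat.one_lt_pow two_ne_zero hp.one_lt) (1 : G)
  have hp0 : (p : ℤ) * (p - 1) ≠ 0 := mul_ne_zero (by exact_mod_cast hp.ne_zero)
    (sub_ne_zero.mpr (by exact_mod_cast hp.ne_one))
  refine dep_of_smul hp0 ?_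
  rw [prime_smul_eq ρ hone hp hcard m]
  exact dep_sub
    (dep_sum _ _ fun g hg =>
      hdep g (Finset.ne_of_mem_erase hg) _ (apply_sum_range_pow ρ hmul (hexp g) m))
    (dep_smul _ (hdep g₀ hg₀ _ (apply_sum_apply ρ hmul g₀ m)))

end Prime

/-! ### Elliptic curves -/

section CurvePrime

open WeierstrassCurve WeierstrassCurve.Affine

variable {F : Type} [Field F] [NumberField F] (W : WeierstrassCurve ℚ) [W.IsElliptic]

/-- **Rank `1` by descent through an automorphism group of order `p²` and exponent `p`** (the
general form of `mordellWeilRank_baseChange_eq_one_of_exponent_three`, covering e.g.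
`Gal(F₅/ℚ) ≅ C₅ × C₅` of the `n = 5` case of Dokchitser–Dokchitser's Theorem 2): for a number
field `F` with `|Aut(F/ℚ)| = p²` of exponent `p`, an elliptic curve `E/ℚ` with a rational point
of infinite order, and number fields `K_σ → F` covering the fixed field of each `σ ≠ 1` with
`rank_ℤ E(K_σ) ≤ 1`, one has `rank_ℤ E(F) = 1`. [folklore] -/
theorem mordellWeilRank_baseChange_eq_one_of_exponent_prime {p : ℕ} (hp : p.Prime)
    (hcardp : Nat.card (F ≃ₐ[ℚ] F) = p ^ 2) (hexp : ∀ σ : F ≃ₐ[ℚ] F, σ ^ p = 1)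
    (hP : ∃ P : (W.baseChange ℚ).toAffine.Point, ∀ n : ℕ, 0 < n → n • P ≠ 0)
    (hK : ∀ σ : F ≃ₐ[ℚ] F, σ ≠ 1 →
      ∃ (K : Type) (_ : Field K) (_ : NumberField K) (_ : Algebra ℚ K) (f : K →ₐ[ℚ] F),
        (∀ x : F, σ x = x → x ∈ f.range) ∧ (W.baseChange K).mordellWeilRank ≤ 1) :
    (W.baseChange F).mordellWeilRank = 1 := by
  obtain ⟨P, hP⟩ := hP
  haveI : (W.baseChange F).IsElliptic := inferInstanceAs (W.map (algebraMap ℚ F)).IsElliptic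
  haveI : Module.Finite ℤ (W.baseChange F).toAffine.Point :=
    (W.baseChange F).module_finite_point_holds
  have hcard : Fintype.card (F ≃ₐ[ℚ] F) = p ^ 2 := by rw [← Nat.card_eq_fintype_card, hcardp]
  set m₀ : (W.baseChange F).toAffine.Point := Point.baseChange (W' := W.toAffine) ℚ F P
    with hm₀def
  have hm₀ : ∀ a : ℤ, a ≠ 0 → a • m₀ ≠ 0 := by
    intro a ha h
    rw [hm₀def, ← map_zsmul, ← map_zero (Point.baseChange (W' := W.toAffine) ℚ F)] at h
    exact hP a.natAbs (Int.natAbs_pos.mpr ha) (by simpa using Point.map_injective _ h)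
  refine finrank_eq_one_of_forall_dep hm₀ (dep_of_exponent_prime
    (fun σ : F ≃ₐ[ℚ] F => Point.map (W' := W.toAffine) (σ : F →ₐ[ℚ] F)) hp
    (fun σ τ m => by rcases m with _ | ⟨x, y, h⟩ <;> rfl)
    (fun m => by rcases m with _ | ⟨x, y, h⟩ <;> rfl) hexp hcard (fun σ hσ m hm => ?_))
  obtain ⟨K, _, _, _, f, hfK, hrank⟩ := hK σ hσ
  haveI : (W.baseChange K).IsElliptic := inferInstanceAs (W.map (algebraMap ℚ K)).IsElliptic
  haveI : Module.Finite ℤ (W.baseChange K).toAffine.Point :=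
    (W.baseChange K).module_finite_point_holds
  set ι : (W.baseChange K).toAffine.Point →+ (W.baseChange F).toAffine.Point :=
    Point.map (W' := W.toAffine) f with hι
  obtain ⟨m', rfl⟩ : ∃ m' : (W.baseChange K).toAffine.Point, ι m' = m := by
    rcases m with _ | ⟨x, y, h⟩
    · exact ⟨0, rfl⟩
    · rw [Point.map_some] at hm
      obtain ⟨hx, hy⟩ := Point.some.inj hm
      rw [AlgEquiv.coe_toAlgHom] at hx hy
      obtain ⟨x₀, rfl⟩ := (AlgHom.mem_range f).mp (hfK x hx)
      obtain ⟨y₀, rfl⟩ := (AlgHom.mem_range f).mp (hfK y hy)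
      have h₀ : (W.baseChange K).toAffine.Nonsingular x₀ y₀ :=
        (baseChange_nonsingular (W := W.toAffine) (f := f) f.injective x₀ y₀).mp h
      exact ⟨Point.some x₀ y₀ h₀, rfl⟩
  set P' : (W.baseChange K).toAffine.Point := Point.baseChange (W' := W.toAffine) ℚ K P with hP'
  have hιP' : ι P' = m₀ := Point.map_baseChange (W' := W.toAffine) f P
  have hdep : ¬ LinearIndependent ℤ ![m', P'] := fun hli => by
    have := hli.fintype_card_le_finrank
    rw [Fintype.card_fin] at this
    exact absurd (this.trans hrank) (by norm_num)
  rw [LinearIndependent.pair_iff] at hdep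
  push Not at hdep
  obtain ⟨s, t, hst, hst0⟩ := hdep
  have hrel : s • ι m' + t • m₀ = 0 := by
    rw [← hιP', ← map_zsmul, ← map_zsmul, ← map_add, hst, map_zero]
  by_cases hs : s = 0
  · rw [hs, zero_smul, zero_add] at hrel
    exact absurd hrel (hm₀ t (hst0 hs))
  · exact ⟨s, -t, hs, by rw [eq_neg_of_add_eq_zero_left hrel, neg_smul]⟩

end CurvePrime

end Literature.Barriers.BirchSwinnertonDyer.DokchitserDokchitser2011

end
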